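import Summits.QuantumFields.BalabanUV.T4Continuum.Support.RegionFaceFluxChart
import Summits.QuantumFields.BalabanUV.T4Continuum.Support.ScalarBlockPoincareLocal

/-!
# T⁴ programme, spine node NE2 (U1a), sub-row Δ1 «NE2⁰-Dirichlet» — BLOCK POINCARÉ AROUND FACE MEANS for star-bond fields:
# `nsq B ≤ 17·Σ_μ nsq (igrad_μ B) + 12·n^d·nsq (Φ(B))` (any union of unit blocks, any `n`, no hypothesis on `B`)

Row NE2 OWNER item O14-a «Δ1-VEC-W1-BOX» (unit `b2b-balaban-t4-ne2-p1`, gen 14; R30 (c), journal 2026-08-20 l.19379 / l.19654), file 2b: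
the Poincaré half of the two-scale TRANSVERSE POINCARÉ inequality (file 3), on the chart of file 2a (`Support/RegionFaceFluxChart`).

 * §3 **`sum_block_le`** (block `y ∈ S`, component `ν`): `Σ_{x ∈ B(y)} ‖ιB(x,ν)‖² ≤ 5·inBlock + 4·n^d·‖Φ(B)(y,ν)‖²` (tree
   `ScalarBlockPoincareLocal.sum_block_norm_sub_mean_sq_le`, constant ½, + file 2a's block-mean-vs-face-mean estimate);
   **`sum_incoming_le`**: the INCOMING normal layer below a block `y + e_ν ∈ S` is dominated by the block above plus its `ν`-differences.
 * §4 THE END **`nsq_le_igrad_add_faceAvg`**: `nsq B ≤ 17·Σ_μ nsq (igrad M S n μ B) + 12·(n^d·nsq (faceAvg n M S *ᵥ B))` for EVERY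
   `B : {b // starReg n M S b} → ℂ` (the `ν`-slices of the interior energies are carried through the assembly so that no factor `d` is lost).

HONEST FRAMING (T4-DAG p. 1).  [folklore] finite lattice calculus on the cell's typed `U = 1` objects; model level (one region = any union of
unit blocks, one averaging scale, finite torus); crude constants (ours); nothing printed is a hypothesis or a conclusion; W1 NOT proved here
(file 3); NE2 (U1a) NOT proved; spine PROVED 0/9 unchanged; NOT [B9] (3.16)/(3.23)–(3.27) as printed; NOT infinite volume / mass gap /
Clay.  HONEST DEPENDENCY: continuum YM on T⁴ ⇐ BetaPertH ∧ nine spine estimates (0/9 proved); BetaPertH ⇐ (D1) ∧ (D4) ∧ CAP+tail; G-an2-4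
gates asym, D1 and NE2/3/4.  No `sorry`.
-/

noncomputable section

open scoped BigOperators ComplexConjugate Matrix
open Finset

namespace Summit.QuantumFields.BalabanUV.T4Continuum.RegionFaceFluxPoincare

open Literature.MathematicalPhysics.QuantumFieldTheory.Balaban1983to89.B5Prop11Plancherel (Tor fine unitVec)
open Literature.MathematicalPhysics.QuantumFieldTheory.Balaban1983to89.B5Prop11Lower (nsq nsq_nonneg)
open Literature.MathematicalPhysics.QuantumFieldTheory.Balaban1983to89.B5Action121 (sdiff sdiff_mulVec)
open Literature.MathematicalPhysics.QuantumFieldTheory.Balaban1983to89.B5Block118 (bpt tstep QsOp QsOp_mulVec)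
open Literature.MathematicalPhysics.QuantumFieldTheory.Balaban1983to89.B5Blocks16 (blockOf blockOf_bpt sum_blocks)
open Literature.MathematicalPhysics.QuantumFieldTheory.Balaban1983to89.B5AverageCurlStokes (sum_blocks_real)
open Summit.QuantumFields.BalabanUV.T4Continuum
open Summit.QuantumFields.BalabanUV.T4Continuum.SubtypeCompression (ext ext_apply_of ext_apply_of_not nsq_ext)
open Summit.QuantumFields.BalabanUV.T4Continuum.ScalarBlockTrialFunction (bpt_add_unitVec_of_lt bpt_add_unitVec_of_eq)
open Summit.QuantumFields.BalabanUV.T4Continuum.ScalarBlockPoincareLocal (sum_block_norm_sub_mean_sq_le)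
open Summit.QuantumFields.BalabanUV.T4Continuum.RegionGaugeFixedVector (starReg)
open Summit.QuantumFields.BalabanUV.T4Continuum.RegionStarLineGauge (lastD)
open Summit.QuantumFields.BalabanUV.T4Continuum.DirichletStarRenormTower (igrad)
open Summit.QuantumFields.BalabanUV.T4Continuum.RegionFaceFlux (faceAvg)
open Summit.QuantumFields.BalabanUV.T4Continuum.RegionFaceFluxChart (gI gI_nonneg gI_eq_of_star sum_gI_eq blockReg_bpt star_of_blockReg
  nsq_blockMean_sub_faceAvg_le)
open Summit.QuantumFields.BalabanUV.Beta.GAN24.DirichletBoxTrace (blockReg)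

variable {d : ℕ} (n : ℕ) [NeZero n] (M : Fin d → ℕ) [hM : ∀ μ, NeZero (M μ)] (S : Tor M → Prop) [DecidablePred S]

section Region

variable (ν : Fin d)

/-! ## §3 Block Poincaré around the face mean; the incoming normal layer -/

/-- the IN-BLOCK interior-difference budget of block `y`, component `ν`: `Σ_μ Σ_{j : j_μ + 1 < n} gI_μ(bpt y j, ν)`. [folklore] -/
def inBlock (B : {b // starReg n M S b} → ℂ) (y : Tor M) : ℝ :=
  ∑ μ, ∑ j ∈ univ.filter (fun j : Fin d → Fin n => (j μ : ℕ) + 1 < n), gI n M S μ B (bpt n M y j, ν)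

/-- `0 ≤ inBlock`. [folklore] -/
theorem inBlock_nonneg (B : {b // starReg n M S b} → ℂ) (y : Tor M) : 0 ≤ inBlock n M S ν B y :=
  Finset.sum_nonneg fun _ _ => Finset.sum_nonneg fun _ _ => gI_nonneg n M S _ B _

/-- `inBlock ≤ Σ_μ Σ_j gI_μ(bpt y j, ν)` (drop the in-block restriction). [folklore] -/
theorem inBlock_le (B : {b // starReg n M S b} → ℂ) (y : Tor M) :
    inBlock n M S ν B y ≤ ∑ μ, ∑ j : Fin d → Fin n, gI n M S μ B (bpt n M y j, ν) :=
  Finset.sum_le_sum fun _ _ => Finset.sum_le_sum_of_subset_of_nonneg (filter_subset _ _) fun _ _ _ => gI_nonneg n M S _ B _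

/-- **BLOCK POINCARÉ AROUND THE FACE MEAN** (block `y ∈ S`, component `ν`):
`Σ_{j} ‖ιB(bpt y j, ν)‖² ≤ 5·inBlock + 4·n^d·‖Φ(B)(y,ν)‖²`. [folklore] -/
theorem sum_block_le (B : {b // starReg n M S b} → ℂ) {y : Tor M} (hy : S y) :
    ∑ j : Fin d → Fin n, ‖ext (starReg n M S) B (bpt n M y j, ν)‖ ^ 2
      ≤ 5 * inBlock n M S ν B y + 4 * ((n : ℝ) ^ d * ‖(faceAvg n M S *ᵥ B) (y, ν)‖ ^ 2) := by
  have hn : (0 : ℝ) < n := by exact_mod_cast Nat.pos_of_ne_zero (NeZero.ne n)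
  set f : Tor (fine n M) → ℂ := fun x => ext (starReg n M S) B (x, ν) with hf
  set m : ℂ := (QsOp n M *ᵥ f) y with hm
  set F : ℂ := (faceAvg n M S *ᵥ B) (y, ν) with hF
  -- the tree's in-block Poincaré around the block mean, read through `gI`
  have hP : ∑ j : Fin d → Fin n, ‖f (bpt n M y j) - m‖ ^ 2 ≤ 1 / 2 * inBlock n M S ν B y := by
    have h := sum_block_norm_sub_mean_sq_le n M f y
    have hc : ((n : ℝ) - 1) / (2 * n) ≤ 1 / 2 := by
      rw [div_le_div_iff₀ (by positivity) (by norm_num)]; linarith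
    have hsame : ∀ μ : Fin d, ∀ j ∈ univ.filter (fun j : Fin d → Fin n => (j μ : ℕ) + 1 < n),
        ‖(sdiff (fine n M) (n : ℂ) μ *ᵥ f) (bpt n M y j)‖ ^ 2 = gI n M S μ B (bpt n M y j, ν) := by
      intro μ j hj
      rw [mem_filter] at hj
      have hc1 : starReg n M S (bpt n M y j, ν) := star_of_blockReg n M S (blockReg_bpt n M S hy j) ν
      have hc2 : starReg n M S (bpt n M y j + unitVec (fine n M) μ, ν) := by
        rw [bpt_add_unitVec_of_lt n M y j μ hj.2]; exact star_of_blockReg n M S (blockReg_bpt n M S hy _) ν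
      rw [gI_eq_of_star n M S μ B _ hc1 hc2, sdiff_mulVec, norm_mul, Complex.norm_natCast, mul_pow]
    have hI : ∑ μ : Fin d, ∑ j ∈ univ.filter (fun j : Fin d → Fin n => (j μ : ℕ) + 1 < n),
        ‖(sdiff (fine n M) (n : ℂ) μ *ᵥ f) (bpt n M y j)‖ ^ 2 = inBlock n M S ν B y :=
      Finset.sum_congr rfl fun μ _ => Finset.sum_congr rfl (hsame μ)
    rw [hI] at h
    exact h.trans (mul_le_mul_of_nonneg_right hc (inBlock_nonneg n M S ν B y))
  -- the block mean against the face mean (§2)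
  have hM' : (n : ℝ) ^ d * ‖m - F‖ ^ 2 ≤ inBlock n M S ν B y := by
    refine (nsq_blockMean_sub_faceAvg_le n M S ν B hy).trans ?_
    unfold inBlock
    rw [← Finset.sum_erase_add _ _ (mem_univ ν)]
    have : 0 ≤ ∑ μ ∈ univ.erase ν, ∑ j ∈ univ.filter (fun j : Fin d → Fin n => (j μ : ℕ) + 1 < n), gI n M S μ B (bpt n M y j, ν) :=
      Finset.sum_nonneg fun _ _ => Finset.sum_nonneg fun _ _ => gI_nonneg n M S _ B _
    linarith
  -- `‖f‖² ≤ 2‖f − m‖² + 2‖m‖²`, `‖m‖² ≤ 2‖m − F‖² + 2‖F‖²`, `Σ_j ‖m‖² = n^d‖m‖²`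
  have h1 : ∀ j : Fin d → Fin n, ‖f (bpt n M y j)‖ ^ 2 ≤ 2 * ‖f (bpt n M y j) - m‖ ^ 2 + 2 * ‖m‖ ^ 2 := by
    intro j
    have e : f (bpt n M y j) = (f (bpt n M y j) - m) + m := by ring
    calc ‖f (bpt n M y j)‖ ^ 2 = ‖(f (bpt n M y j) - m) + m‖ ^ 2 := by rw [← e]
      _ ≤ (‖f (bpt n M y j) - m‖ + ‖m‖) ^ 2 := by gcongr; exact norm_add_le _ _
      _ ≤ 2 * ‖f (bpt n M y j) - m‖ ^ 2 + 2 * ‖m‖ ^ 2 := by nlinarith [sq_nonneg (‖f (bpt n M y j) - m‖ - ‖m‖)]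
  have h2 : ‖m‖ ^ 2 ≤ 2 * ‖m - F‖ ^ 2 + 2 * ‖F‖ ^ 2 := by
    have e : m = (m - F) + F := by ring
    calc ‖m‖ ^ 2 = ‖(m - F) + F‖ ^ 2 := by rw [← e]
      _ ≤ (‖m - F‖ + ‖F‖) ^ 2 := by gcongr; exact norm_add_le _ _
      _ ≤ 2 * ‖m - F‖ ^ 2 + 2 * ‖F‖ ^ 2 := by nlinarith [sq_nonneg (‖m - F‖ - ‖F‖)]
  have hcard : ∑ _j : Fin d → Fin n, ‖m‖ ^ 2 = (n : ℝ) ^ d * ‖m‖ ^ 2 := by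
    rw [Finset.sum_const, card_univ, Fintype.card_fun, Fintype.card_fin, Fintype.card_fin, nsmul_eq_mul, Nat.cast_pow]
  calc ∑ j : Fin d → Fin n, ‖f (bpt n M y j)‖ ^ 2
      ≤ ∑ j : Fin d → Fin n, (2 * ‖f (bpt n M y j) - m‖ ^ 2 + 2 * ‖m‖ ^ 2) := Finset.sum_le_sum fun j _ => h1 j
    _ = 2 * ∑ j : Fin d → Fin n, ‖f (bpt n M y j) - m‖ ^ 2 + 2 * ((n : ℝ) ^ d * ‖m‖ ^ 2) := by
        rw [Finset.sum_add_distrib, ← Finset.mul_sum, ← Finset.mul_sum, hcard]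
    _ ≤ 2 * (1 / 2 * inBlock n M S ν B y) + 2 * ((n : ℝ) ^ d * (2 * ‖m - F‖ ^ 2 + 2 * ‖F‖ ^ 2)) := by gcongr
    _ = inBlock n M S ν B y + 4 * ((n : ℝ) ^ d * ‖m - F‖ ^ 2) + 4 * ((n : ℝ) ^ d * ‖F‖ ^ 2) := by ring
    _ ≤ inBlock n M S ν B y + 4 * inBlock n M S ν B y + 4 * ((n : ℝ) ^ d * ‖F‖ ^ 2) := by gcongr
    _ = 5 * inBlock n M S ν B y + 4 * ((n : ℝ) ^ d * ‖F‖ ^ 2) := by ring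

/-- **THE INCOMING NORMAL LAYER** (below a block `y + e_ν ∈ S`): the star bonds at the last `ν`-digit of `B(y)` are dominated by the block
above and the `ν`-differences across the face: `Σ_{j : j_ν+1 = n} ‖ιB(bpt y j, ν)‖² ≤ 2·Σ_j ‖ιB(bpt (y+e_ν) j, ν)‖² + 2·Σ_j gI_ν(bpt y j, ν)`.
[folklore] -/
theorem sum_incoming_le (B : {b // starReg n M S b} → ℂ) {y : Tor M} (hy' : S (y + unitVec M ν)) :
    ∑ j ∈ univ.filter (fun j : Fin d → Fin n => (j ν : ℕ) + 1 = n), ‖ext (starReg n M S) B (bpt n M y j, ν)‖ ^ 2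
      ≤ 2 * ∑ j : Fin d → Fin n, ‖ext (starReg n M S) B (bpt n M (y + unitVec M ν) j, ν)‖ ^ 2
        + 2 * ∑ j : Fin d → Fin n, gI n M S ν B (bpt n M y j, ν) := by
  set f : Tor (fine n M) × Fin d → ℂ := ext (starReg n M S) B with hf
  -- pointwise: across the face
  have hpt : ∀ j ∈ univ.filter (fun j : Fin d → Fin n => (j ν : ℕ) + 1 = n),
      ‖f (bpt n M y j, ν)‖ ^ 2 ≤ 2 * ‖f (bpt n M (y + unitVec M ν) (Function.update j ν 0), ν)‖ ^ 2 + 2 * gI n M S ν B (bpt n M y j, ν) := by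
    intro j hj
    rw [mem_filter] at hj
    have hup : bpt n M y j + unitVec (fine n M) ν = bpt n M (y + unitVec M ν) (Function.update j ν 0) := bpt_add_unitVec_of_eq n M y j ν hj.2
    have hin : blockReg n M S (bpt n M y j + unitVec (fine n M) ν) := by rw [hup]; exact blockReg_bpt n M S hy' _
    have hc1 : starReg n M S (bpt n M y j, ν) := Or.inr hin
    have hc2 : starReg n M S (bpt n M y j + unitVec (fine n M) ν, ν) := Or.inl hin
    have hg : gI n M S ν B (bpt n M y j, ν) = (n : ℝ) ^ 2 * ‖f (bpt n M y j + unitVec (fine n M) ν, ν) - f (bpt n M y j, ν)‖ ^ 2 :=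
      gI_eq_of_star n M S ν B _ hc1 hc2
    rw [← hup]
    have hn1 : (1 : ℝ) ≤ (n : ℝ) ^ 2 := by
      have : (1 : ℝ) ≤ n := by exact_mod_cast Nat.one_le_iff_ne_zero.mpr (NeZero.ne n)
      nlinarith
    have h3 : ‖f (bpt n M y j, ν)‖ ^ 2 ≤ 2 * ‖f (bpt n M y j + unitVec (fine n M) ν, ν)‖ ^ 2
        + 2 * ‖f (bpt n M y j + unitVec (fine n M) ν, ν) - f (bpt n M y j, ν)‖ ^ 2 := by
      have e : f (bpt n M y j, ν) = f (bpt n M y j + unitVec (fine n M) ν, ν) - (f (bpt n M y j + unitVec (fine n M) ν, ν) - f (bpt n M y j, ν)) := by ring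
      calc ‖f (bpt n M y j, ν)‖ ^ 2
          = ‖f (bpt n M y j + unitVec (fine n M) ν, ν) - (f (bpt n M y j + unitVec (fine n M) ν, ν) - f (bpt n M y j, ν))‖ ^ 2 := by rw [← e]
        _ ≤ (‖f (bpt n M y j + unitVec (fine n M) ν, ν)‖ + ‖f (bpt n M y j + unitVec (fine n M) ν, ν) - f (bpt n M y j, ν)‖) ^ 2 := by
            gcongr; exact norm_sub_le _ _
        _ ≤ _ := by nlinarith [sq_nonneg (‖f (bpt n M y j + unitVec (fine n M) ν, ν)‖ - ‖f (bpt n M y j + unitVec (fine n M) ν, ν) - f (bpt n M y j, ν)‖)]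
    have h4 : ‖f (bpt n M y j + unitVec (fine n M) ν, ν) - f (bpt n M y j, ν)‖ ^ 2 ≤ gI n M S ν B (bpt n M y j, ν) := by
      rw [hg]
      have : 0 ≤ ‖f (bpt n M y j + unitVec (fine n M) ν, ν) - f (bpt n M y j, ν)‖ ^ 2 := by positivity
      nlinarith
    linarith
  refine (Finset.sum_le_sum hpt).trans ?_
  rw [Finset.sum_add_distrib, ← Finset.mul_sum, ← Finset.mul_sum]
  -- the fiber bijection `j ↦ j[ν ↦ 0]` from the last digit onto the first digit, then drop the filter
  have hA : ∑ j ∈ univ.filter (fun j : Fin d → Fin n => (j ν : ℕ) + 1 = n), ‖f (bpt n M (y + unitVec M ν) (Function.update j ν 0), ν)‖ ^ 2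
      ≤ ∑ j : Fin d → Fin n, ‖f (bpt n M (y + unitVec M ν) j, ν)‖ ^ 2 := by
    have hb : ∑ j ∈ univ.filter (fun j : Fin d → Fin n => (j ν : ℕ) + 1 = n), ‖f (bpt n M (y + unitVec M ν) (Function.update j ν 0), ν)‖ ^ 2
        = ∑ j ∈ univ.filter (fun j : Fin d → Fin n => j ν = 0), ‖f (bpt n M (y + unitVec M ν) j, ν)‖ ^ 2 := by
      refine Finset.sum_nbij' (fun j => Function.update j ν 0) (fun j => Function.update j ν (lastD n)) ?_ ?_ ?_ ?_ ?_
      · intro j _; simp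
      · intro j _
        simp only [mem_filter, mem_univ, true_and, Function.update_self, lastD]
        have := Nat.pos_of_ne_zero (NeZero.ne n); omega
      · intro j hj
        simp only [mem_filter, mem_univ, true_and] at hj
        rw [Function.update_idem]
        have : lastD n = j ν := by
          ext; simp only [lastD]; omega
        rw [this, Function.update_eq_self]
      · intro j hj
        simp only [mem_filter, mem_univ, true_and] at hj
        rw [Function.update_idem, ← hj, Function.update_eq_self]
      · intro j _; rfl
    rw [hb]
    exact Finset.sum_le_sum_of_subset_of_nonneg (filter_subset _ _) fun _ _ _ => by positivity
  have hB : ∑ j ∈ univ.filter (fun j : Fin d → Fin n => (j ν : ℕ) + 1 = n), gI n M S ν B (bpt n M y j, ν)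
      ≤ ∑ j : Fin d → Fin n, gI n M S ν B (bpt n M y j, ν) :=
    Finset.sum_le_sum_of_subset_of_nonneg (filter_subset _ _) fun _ _ _ => gI_nonneg n M S _ B _
  linarith

/-! ## §4 The END: `nsq B ≤ 17·Σ_μ nsq (igrad_μ B) + 12·n^d·nsq (Φ(B))` -/

/-- off `S` and off the incoming layer the zero-extension vanishes in the chart. [folklore] -/
theorem ext_bpt_eq_zero (B : {b // starReg n M S b} → ℂ) {y : Tor M} (hy : ¬ S y) (j : Fin d → Fin n)
    (h : ¬ ((j ν : ℕ) + 1 = n ∧ S (y + unitVec M ν))) : ext (starReg n M S) B (bpt n M y j, ν) = 0 := by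
  apply ext_apply_of_not
  have hb : ∀ (y' : Tor M) (j' : Fin d → Fin n), blockReg n M S (bpt n M y' j') ↔ S y' := fun y' j' => by
    show S (blockOf n M (bpt n M y' j')) ↔ S y'; rw [blockOf_bpt]
  rintro (h1 | h2)
  · exact hy ((hb y j).mp h1)
  · -- `bpt y j + e_ν` is in block `y` (digit `< n−1`) or in block `y + e_ν` (digit `= n−1`)
    change blockReg n M S (bpt n M y j + unitVec (fine n M) ν) at h2
    rcases Nat.lt_or_ge ((j ν : ℕ) + 1) n with hlt | hge
    · rw [bpt_add_unitVec_of_lt n M y j ν hlt] at h2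
      exact hy ((hb y _).mp h2)
    · have heq : (j ν : ℕ) + 1 = n := by have := (j ν).isLt; omega
      rw [bpt_add_unitVec_of_eq n M y j ν heq] at h2
      exact h ⟨heq, (hb _ _).mp h2⟩

/-- per block and component: the chart sum of `‖ιB_ν‖²` over block `y`, in all membership cases. [folklore] -/
theorem sum_chart_le (B : {b // starReg n M S b} → ℂ) (y : Tor M) :
    ∑ j : Fin d → Fin n, ‖ext (starReg n M S) B (bpt n M y j, ν)‖ ^ 2
      ≤ (if S y then 5 * inBlock n M S ν B y + 4 * ((n : ℝ) ^ d * ‖(faceAvg n M S *ᵥ B) (y, ν)‖ ^ 2) else 0)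
        + (if S (y + unitVec M ν) then 2 * ∑ j : Fin d → Fin n, ‖ext (starReg n M S) B (bpt n M (y + unitVec M ν) j, ν)‖ ^ 2 else 0)
        + 2 * ∑ j : Fin d → Fin n, gI n M S ν B (bpt n M y j, ν) := by
  have hg0 : 0 ≤ 2 * ∑ j : Fin d → Fin n, gI n M S ν B (bpt n M y j, ν) := by
    have := Finset.sum_nonneg fun j (_ : j ∈ (univ : Finset (Fin d → Fin n))) => gI_nonneg n M S ν B (bpt n M y j, ν)
    positivity
  have hf0 : 0 ≤ (if S (y + unitVec M ν) then 2 * ∑ j : Fin d → Fin n, ‖ext (starReg n M S) B (bpt n M (y + unitVec M ν) j, ν)‖ ^ 2 else 0) := by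
    split_ifs
    · positivity
    · exact le_rfl
  by_cases hy : S y
  · rw [if_pos hy]
    have h := sum_block_le n M S ν B hy
    linarith
  · rw [if_neg hy, zero_add]
    by_cases hy' : S (y + unitVec M ν)
    · rw [if_pos hy']
      -- only the last digit survives
      have hsplit : ∑ j : Fin d → Fin n, ‖ext (starReg n M S) B (bpt n M y j, ν)‖ ^ 2
          = ∑ j ∈ univ.filter (fun j : Fin d → Fin n => (j ν : ℕ) + 1 = n), ‖ext (starReg n M S) B (bpt n M y j, ν)‖ ^ 2 := by
        rw [Finset.sum_filter]
        refine Finset.sum_congr rfl fun j _ => ?_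
        split_ifs with h
        · rfl
        · rw [ext_bpt_eq_zero n M S ν B hy j (fun h' => h h'.1), norm_zero, zero_pow two_ne_zero]
      rw [hsplit]
      exact sum_incoming_le n M S ν B hy'
    · rw [if_neg hy', zero_add]
      refine le_trans (le_of_eq (Finset.sum_eq_zero fun j _ => ?_)) hg0
      rw [ext_bpt_eq_zero n M S ν B hy j (fun h' => hy' h'.2), norm_zero, zero_pow two_ne_zero]

end Region

/-- **THE END — BLOCK POINCARÉ AROUND FACE MEANS FOR STAR-BOND FIELDS**: for EVERY `B` on the star bonds of ANY union of unit blocks,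
`nsq B ≤ 17·Σ_μ nsq (igrad_μ B) + 12·(n^d·nsq (Φ(B)))`. [folklore] -/
theorem nsq_le_igrad_add_faceAvg (B : {b // starReg n M S b} → ℂ) :
    nsq B ≤ 17 * ∑ μ, nsq (igrad M S n μ B) + 12 * ((n : ℝ) ^ d * nsq (faceAvg n M S *ᵥ B)) := by
  set f : Tor (fine n M) × Fin d → ℂ := ext (starReg n M S) B with hf
  -- `nsq B` in the chart
  have h0 : nsq B = ∑ ν : Fin d, ∑ y : Tor M, ∑ j : Fin d → Fin n, ‖f (bpt n M y j, ν)‖ ^ 2 := by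
    rw [← nsq_ext (starReg n M S) B, nsq, Fintype.sum_prod_type_right]
    exact Finset.sum_congr rfl fun ν _ => sum_blocks_real n M (fun x => ‖f (x, ν)‖ ^ 2)
  -- the `ν`-slices `T μ ν` of the interior-difference energies: `Σ_ν T μ ν = nsq (igrad_μ B)`
  set T : Fin d → Fin d → ℝ := fun μ ν => ∑ y : Tor M, ∑ j : Fin d → Fin n, gI n M S μ B (bpt n M y j, ν) with hT
  have hTsum : ∀ μ : Fin d, ∑ ν, T μ ν = nsq (igrad M S n μ B) := by
    intro μ
    rw [← sum_gI_eq n M S μ B, Fintype.sum_prod_type_right]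
    exact Finset.sum_congr rfl fun ν _ => (sum_blocks_real n M (fun x => gI n M S μ B (x, ν))).symm
  have hT0 : ∀ μ ν : Fin d, 0 ≤ T μ ν := fun μ ν => Finset.sum_nonneg fun _ _ => Finset.sum_nonneg fun _ _ => gI_nonneg n M S _ B _
  have hF0 : ∀ ν : Fin d, 0 ≤ (n : ℝ) ^ d * ∑ y : Tor M, ‖(faceAvg n M S *ᵥ B) (y, ν)‖ ^ 2 := fun ν => by positivity
  have hIB : ∀ ν : Fin d, ∑ y : Tor M, (if S y then 5 * inBlock n M S ν B y + 4 * ((n : ℝ) ^ d * ‖(faceAvg n M S *ᵥ B) (y, ν)‖ ^ 2) else 0)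
      ≤ 5 * ∑ μ, T μ ν + 4 * ((n : ℝ) ^ d * ∑ y : Tor M, ‖(faceAvg n M S *ᵥ B) (y, ν)‖ ^ 2) := by
    intro ν
    calc ∑ y : Tor M, (if S y then 5 * inBlock n M S ν B y + 4 * ((n : ℝ) ^ d * ‖(faceAvg n M S *ᵥ B) (y, ν)‖ ^ 2) else 0)
        ≤ ∑ y : Tor M, (5 * ∑ μ, ∑ j : Fin d → Fin n, gI n M S μ B (bpt n M y j, ν) + 4 * ((n : ℝ) ^ d * ‖(faceAvg n M S *ᵥ B) (y, ν)‖ ^ 2)) :=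
          Finset.sum_le_sum fun y _ => by
            have h5 := inBlock_le n M S ν B y
            have h6 : 0 ≤ ∑ μ, ∑ j : Fin d → Fin n, gI n M S μ B (bpt n M y j, ν) :=
              Finset.sum_nonneg fun _ _ => Finset.sum_nonneg fun _ _ => gI_nonneg n M S _ B _
            split_ifs
            · linarith
            · positivity
      _ = 5 * ∑ μ, T μ ν + 4 * ((n : ℝ) ^ d * ∑ y : Tor M, ‖(faceAvg n M S *ᵥ B) (y, ν)‖ ^ 2) := by
          rw [Finset.sum_add_distrib, ← Finset.mul_sum, ← Finset.mul_sum, ← Finset.mul_sum, Finset.sum_comm]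
  have hSH : ∀ ν : Fin d, ∑ y : Tor M, (if S (y + unitVec M ν) then 2 * ∑ j : Fin d → Fin n, ‖f (bpt n M (y + unitVec M ν) j, ν)‖ ^ 2 else 0)
      = ∑ y : Tor M, (if S y then 2 * ∑ j : Fin d → Fin n, ‖f (bpt n M y j, ν)‖ ^ 2 else 0) := fun ν =>
    Fintype.sum_equiv (Equiv.addRight (unitVec M ν)) _ _ (fun y => rfl)
  have hS2 : ∀ ν : Fin d, ∑ y : Tor M, (if S y then 2 * ∑ j : Fin d → Fin n, ‖f (bpt n M y j, ν)‖ ^ 2 else 0)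
      ≤ 2 * (5 * ∑ μ, T μ ν + 4 * ((n : ℝ) ^ d * ∑ y : Tor M, ‖(faceAvg n M S *ᵥ B) (y, ν)‖ ^ 2)) := by
    intro ν
    calc ∑ y : Tor M, (if S y then 2 * ∑ j : Fin d → Fin n, ‖f (bpt n M y j, ν)‖ ^ 2 else 0)
        ≤ ∑ y : Tor M, 2 * (if S y then 5 * inBlock n M S ν B y + 4 * ((n : ℝ) ^ d * ‖(faceAvg n M S *ᵥ B) (y, ν)‖ ^ 2) else 0) :=
          Finset.sum_le_sum fun y _ => by
            split_ifs with hy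
            · have := sum_block_le n M S ν B hy; linarith
            · simp
      _ = 2 * ∑ y : Tor M, (if S y then 5 * inBlock n M S ν B y + 4 * ((n : ℝ) ^ d * ‖(faceAvg n M S *ᵥ B) (y, ν)‖ ^ 2) else 0) := by
          rw [← Finset.mul_sum]
      _ ≤ _ := mul_le_mul_of_nonneg_left (hIB ν) (by norm_num)
  -- assemble per `ν`
  have hν : ∀ ν : Fin d, ∑ y : Tor M, ∑ j : Fin d → Fin n, ‖f (bpt n M y j, ν)‖ ^ 2
      ≤ 17 * ∑ μ, T μ ν + 12 * ((n : ℝ) ^ d * ∑ y : Tor M, ‖(faceAvg n M S *ᵥ B) (y, ν)‖ ^ 2) := by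
    intro ν
    have h1 := Finset.sum_le_sum fun y (_ : y ∈ (univ : Finset (Tor M))) => sum_chart_le n M S ν B y
    rw [Finset.sum_add_distrib, Finset.sum_add_distrib, hSH ν, ← Finset.mul_sum] at h1
    have h2 := hIB ν
    have h3 := hS2 ν
    have h4 : T ν ν ≤ ∑ μ, T μ ν := by
      rw [← Finset.sum_erase_add _ _ (mem_univ ν)]
      have : 0 ≤ ∑ μ ∈ univ.erase ν, T μ ν := Finset.sum_nonneg fun _ _ => hT0 _ _
      linarith
    have h5 := hF0 ν
    change ∑ y : Tor M, ∑ j : Fin d → Fin n, ‖f (bpt n M y j, ν)‖ ^ 2 ≤ _ + _ + 2 * T ν ν at h1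
    linarith
  -- sum over `ν`
  rw [h0]
  refine (Finset.sum_le_sum fun ν _ => hν ν).trans (le_of_eq ?_)
  rw [Finset.sum_add_distrib, ← Finset.mul_sum, ← Finset.mul_sum, Finset.sum_comm, ← Finset.mul_sum, nsq,
    Fintype.sum_prod_type_right]
  congr 1
  rw [Finset.sum_congr rfl fun μ _ => hTsum μ]

end Summit.QuantumFields.BalabanUV.T4Continuum.RegionFaceFluxPoincare

end
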